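import Literature.AlgebraicGeometry.Resolution.EquivariantLocalBlowup
import HarnessLib

/-!
# Stability criterion for local models: an automorphism that moves the GENERATORS of a model into its LOCAL RING at the
# centre of a stable valuation stabilises that local ring ([CoP1] Lemma 9.4, "`S` is stable by `G`", repaired form)

OURS (decomp-res hand-1 g20; crux `stmt-ResolutionOfSingularities-15917`, stub 2 of `Cruxes/CleanModels/Lines/Sketch.lean` rev 35,
leaf `CossartPiltant2008_lemma94_kummerCore` / `hStabLoc`).  A def-free TOOL file in the vocabulary of
`Literature/AlgebraicGeometry/Resolution/LocalBlowup.lean` (`locAtCentre`) and `EquivariantLocalBlowup.lean`.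

The sentence of [CoP1] Lemma 9.4 (HAL hal-00139124 p. 29) "`S` is stable by `G`, since any conjugate of `S` is dominated by `W`, hence
equal to `S`" is false for an arbitrary local uniformization `S` (two `G`-conjugate small resolutions of a `G`-stable compound Du Val
point, `Cruxes/CleanModels/Lines/Sketch-memo-hand1-g19.md` (F5), `…-g20.md` §2 (B)).  The tree's `locAtCentre_map_mem_of_stable`
(`EquivariantLocalBlowup.lean`) gives stability of the local ring `C_{𝔪_O ∩ C}` when the MODEL `C` itself is `σ`-stable.  This file proves
the sharper criterion used in hand-1 g20's analysis (memo §2 (C1)): it suffices that `σ` map each GENERATOR of `C` into the LOCAL RING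
`locAtCentre C O` — the model `C = B[t, c]` need not be stable.  In particular (`…_of_fixed_of_sub_mem`): if `C` is generated over a
pointwise-fixed subring `B` by elements `t` whose displacements `σ a − a` lie in the local ring and by pointwise-fixed elements `c`, then
the local ring is `σ`-stable.  Consequence recorded in the memo: the equivariant local uniformization `hStabLoc` of the tree's chain for
Cossart–Piltant 2019 Prop. 4.10 follows from INVARIANT COFINALITY («every local uniformization `T` of the upper field and every finite
`E ⊆ O_W` admit invariant elements `c ⊆ O_V ∩ A` with `T[c]_W` regular and `E ⊆ T[c]_W`»), applied to `E = {σ a − a : a ∈ t}`.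

* `locAtCentre_map_mem_of_generators` — `σ O ⊆ O`, `C = closure g`, `σ a ∈ locAtCentre C O` for all `a ∈ g` ⟹
  `σ (locAtCentre C O) ⊆ locAtCentre C O`;
* `locAtCentre_map_mem_of_sub_mem` — the same with the hypothesis `σ a − a ∈ locAtCentre C O`;
* `locAtCentre_map_mem_of_fixed_of_sub_mem` — the shape `C = closure (B ∪ t ∪ c)`, `B` and `c` fixed pointwise, `σ a − a ∈ locAtCentre C O`
  for `a ∈ t`;
* `locAtCentre_adjoin_map_mem_of_fixed_of_sub_mem` — the same for `C = (Algebra.adjoin S (t ∪ c)).toSubring` with `σ` fixing the image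
  of `S` (the frame of the chain `ArithmeticalThreefoldsLocalDescent*.lean`).

Everything PROVED; no definitions, no named facts; [folklore] commutative algebra.  Nothing here proves resolution of singularities in
positive characteristic or any statement of a manuscript under adjudication; rung 0.  AI-written; AI review weaker than expert review.
[cite: CossartPiltant2008, proof of Lemma 9.4 (HAL hal-00139124 p. 29), "S is stable by G"] [cite: NovacoskiSpivakovsky2014, Def. 2.8]
-/

-- `Summit.<Summit>.<Sub>.Theorems` with `Sub = Summit` (single-conjunct summit, D-0017)
set_option linter.dupNamespace false

noncomputable section

open Literature.AlgebraicGeometry.Resolution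

namespace Summit.ResolutionOfSingularities.ResolutionOfSingularities.Theorems.RadicialJung.CleanModels.StabilityCriterion

universe u

variable {K : Type u} [Field K]

/-- **Units of `O` stay units of `O`**: for a ring automorphism `σ` of `K` with `σ O ⊆ O` and `v(s) = 1`, also `v(σ s) = 1`
(`σ s ∈ O` and `σ s⁻¹ = (σ s)⁻¹ ∈ O`). [folklore] -/
theorem valuation_map_eq_one_of_eq_one (σ : K ≃+* K) (O : ValuationSubring K) (hσO : ∀ z ∈ O, σ z ∈ O)
    {s : K} (hs1 : O.valuation s = 1) : O.valuation (σ s) = 1 := by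
  have hs0 : s ≠ 0 := ne_zero_of_valuation_eq_one hs1
  have hsO : s ∈ O := by rw [← O.valuation_le_one_iff, hs1]
  refine le_antisymm ((O.valuation_le_one_iff _).mpr (hσO _ hsO)) ?_
  have hsinv : s⁻¹ ∈ O := by
    rw [← O.valuation_le_one_iff, map_inv₀, hs1, inv_one]
  have h := (O.valuation_le_one_iff _).mpr (hσO _ hsinv)
  rw [map_inv₀, map_inv₀, inv_le_one₀ ((Valuation.pos_iff _).mpr
    (fun e => hs0 (by simpa using congrArg σ.symm e)))] at h
  exact h

/-- **Stability criterion for local rings at the centre (generators form).** Let `σ` be a ring automorphism of `K` preserving the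
valuation ring `O` (`σ O ⊆ O`), and `C = closure g` the subring generated by `g` (the case of interest is `C ⊆ O`, but this is not needed).  If `σ` maps every generator `a ∈ g` into the local
ring `locAtCentre C O = C_{𝔪_O ∩ C}`, then `σ` maps `locAtCentre C O` into itself.  Proof: `σ` maps `C` into the subring
`locAtCentre C O` (closure induction), and a denominator `s ∈ C` with `v(s) = 1` goes to `σ s ∈ locAtCentre C O` with `v(σ s) = 1`, whose
inverse lies in the local ring (`inv_mem_locAtCentre`).  The model `C` itself need NOT be `σ`-stable (compare
`locAtCentre_map_mem_of_stable`). [folklore] [cite: CossartPiltant2008, proof of Lemma 9.4 (HAL p. 29), "S is stable by G"] -/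
theorem locAtCentre_map_mem_of_generators (σ : K ≃+* K) (O : ValuationSubring K) (hσO : ∀ z ∈ O, σ z ∈ O)
    {g : Set K} (hg : ∀ a ∈ g, σ a ∈ locAtCentre (Subring.closure g) O) :
    ∀ z ∈ locAtCentre (Subring.closure g) O, σ z ∈ locAtCentre (Subring.closure g) O := by
  set C := Subring.closure g with hC
  -- `σ` maps `C` into the local ring
  have hσC : ∀ c ∈ C, σ c ∈ locAtCentre C O := by
    have hle : C ≤ (locAtCentre C O).comap σ.toRingHom := Subring.closure_le.mpr fun a ha => hg a ha
    intro c hc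
    exact hle hc
  intro z hz
  obtain ⟨y, hy, s, hs, hsv, rfl⟩ := mem_locAtCentre_iff.mp hz
  rw [map_div₀, div_eq_mul_inv]
  exact Subring.mul_mem _ (hσC y hy)
    (inv_mem_locAtCentre (hσC s hs) (valuation_map_eq_one_of_eq_one σ O hσO hsv))

/-- **Stability criterion (displacement form).** As `locAtCentre_map_mem_of_generators`, with the hypothesis that the DISPLACEMENT
`σ a − a` of every generator lies in the local ring (`σ a = (σ a − a) + a`). [folklore]
[cite: CossartPiltant2008, proof of Lemma 9.4 (HAL p. 29), "S is stable by G"] -/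
theorem locAtCentre_map_mem_of_sub_mem (σ : K ≃+* K) (O : ValuationSubring K) (hσO : ∀ z ∈ O, σ z ∈ O)
    {g : Set K} (hg : ∀ a ∈ g, σ a - a ∈ locAtCentre (Subring.closure g) O) :
    ∀ z ∈ locAtCentre (Subring.closure g) O, σ z ∈ locAtCentre (Subring.closure g) O := by
  refine locAtCentre_map_mem_of_generators σ O hσO fun a ha => ?_
  have h : σ a = (σ a - a) + a := by ring
  rw [h]
  exact Subring.add_mem _ (hg a ha) (le_locAtCentre _ O (Subring.subset_closure ha))

/-- **Stability criterion for models generated by fixed and displaced elements** (hand-1 g20 memo §2 (C1)).  Let `σ O ⊆ O` and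
`C = closure (B ∪ t ∪ c)` with `B` a subring fixed pointwise by `σ` (e.g. the image of the base `S ⊆ A = N^G`), `c` fixed pointwise
(INVARIANT new generators), and `σ a − a ∈ locAtCentre C O` for `a ∈ t`.  Then `σ (locAtCentre C O) ⊆ locAtCentre C O`.  With `σ` a
generator of `Gal(N | A)` in a totally ramified Kummer step this is the statement «`T* = B[t, c]_W ∋ σ t_a − t_a` for all `a` ⟹ `T*` is
`G`-stable», which reduces the equivariant local uniformization of the tame layer of Cossart–Piltant 2019 Prop. 4.10 to cofinality with
INVARIANT generators. [folklore] [cite: CossartPiltant2008, proof of Lemma 9.4 (HAL p. 29), "S is stable by G"] -/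
theorem locAtCentre_map_mem_of_fixed_of_sub_mem (σ : K ≃+* K) (O : ValuationSubring K) (hσO : ∀ z ∈ O, σ z ∈ O)
    (B : Subring K) (hσB : ∀ b ∈ B, σ b = b) (t c : Set K) (hσc : ∀ x ∈ c, σ x = x)
    (ht : ∀ a ∈ t, σ a - a ∈ locAtCentre (Subring.closure ((B : Set K) ∪ t ∪ c)) O) :
    ∀ z ∈ locAtCentre (Subring.closure ((B : Set K) ∪ t ∪ c)) O,
      σ z ∈ locAtCentre (Subring.closure ((B : Set K) ∪ t ∪ c)) O := by
  refine locAtCentre_map_mem_of_sub_mem σ O hσO ?_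
  rintro a ((hb | ha) | hc)
  · rw [hσB a hb, sub_self]; exact Subring.zero_mem _
  · exact ht a ha
  · rw [hσc a hc, sub_self]; exact Subring.zero_mem _

/-- **The same in the frame of the chain `ArithmeticalThreefoldsLocalDescent*.lean`**: `K` an algebra over the base `S` whose image `σ`
fixes pointwise, `C = (Algebra.adjoin S (t ∪ c)).toSubring`, `c` fixed pointwise, `σ a − a ∈ locAtCentre C O` for `a ∈ t` ⟹ the local
ring `locAtCentre C O` is mapped into itself by `σ`. [folklore] [cite: CossartPiltant2008, proof of Lemma 9.4 (HAL p. 29), "S is stable by G"] -/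
theorem locAtCentre_adjoin_map_mem_of_fixed_of_sub_mem {S : Type u} [CommRing S] [Algebra S K]
    (σ : K ≃+* K) (O : ValuationSubring K) (hσO : ∀ z ∈ O, σ z ∈ O)
    (hσS : ∀ s : S, σ (algebraMap S K s) = algebraMap S K s) (t c : Set K) (hσc : ∀ x ∈ c, σ x = x)
    (ht : ∀ a ∈ t, σ a - a ∈ locAtCentre (Algebra.adjoin S (t ∪ c)).toSubring O) :
    ∀ z ∈ locAtCentre (Algebra.adjoin S (t ∪ c)).toSubring O,
      σ z ∈ locAtCentre (Algebra.adjoin S (t ∪ c)).toSubring O := by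
  have hcl : (Algebra.adjoin S (t ∪ c)).toSubring = Subring.closure (Set.range (algebraMap S K) ∪ (t ∪ c)) :=
    Algebra.adjoin_eq_ring_closure _
  rw [hcl] at ht ⊢
  refine locAtCentre_map_mem_of_sub_mem σ O hσO ?_
  rintro a (⟨s, rfl⟩ | ha | hc)
  · rw [hσS s, sub_self]; exact Subring.zero_mem _
  · exact ht a ha
  · rw [hσc a hc, sub_self]; exact Subring.zero_mem _

end Summit.ResolutionOfSingularities.ResolutionOfSingularities.Theorems.RadicialJung.CleanModels.StabilityCriterion

end
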